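import Summits.CriticalPhenomena.PercolationContinuityZ3.Theorems.PercNearOneGluingNoHeavyLowerTailBlockQ9PatternBounds
import Summits.CriticalPhenomena.PercolationContinuityZ3.Theorems.PercNearOneGluingAdditiveGluingFingerSetForm
import Summits.CriticalPhenomena.PercolationContinuityZ3.Theorems.PercNearOneGluingAdditiveGluingBasePeel
import HarnessLib

/-!
# `NoHeavyLowerTail` (stmt-CriticalPhenomena-4575) — the CONTACT (κ) pattern bound for block Question 9, and the two-hub
# median/contact certificate

Support file (hull-port prover `prim-hp-1` gen 14; `--supports stmt-CriticalPhenomena-4575`).  No definitions, no named facts,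
no sorries.  Memo: `run/shared/lean/prim/prim-hp-1/HULLPORT-COUPLING.md` §53, `CONJECTURES-gen14.md`.

Setting as `…BlockQ9PatternBounds.lean`: block `O`, a pattern `T` of a set `F` of boundary pairs; `Q_T := pinW w F T` the UNGLUED
pinned graph (split world: each block vertex attached exactly to its ports in `T`), `P_T := pinW (glue_O w) F T = glue_O Q_T` the
glued one.

* `BlockQ9.pattern_kappa` — the CONTACT bound, any block size:
  `μ_{Q_T}(⋃_{o∈O} o ↔ b) − μ_{Q_T}({a ↔ b} ∪ ⋃_{o∈O} {a ↔ o}) ≤ μ_{P_T}(O ↔ b) − μ_{P_T}(a ↔ b)`: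
  gluing the block does not change `{O ↔ b}` (`glue_preimage_iUnion_openConn`) and a glued path `a → b` either avoids the block
  or enters it (`reachable_or_exists_mem_of_glue`, first-entry form).  In words: the glued advantage of the block over the anchor
  is at least "the attached set reaches `b`" minus "the anchor reaches the attached set or `b`", both in the split world.
* `BlockQ9.blockQ9_twoHub_of_medianKappaCertificate` — two-hub block `O = {u₁,u₂}`: if for some partition of the non-empty patterns
  into EXACT / MEDIAN / CONTACT cells the weighted sum `Σ cw T · bound(T)` is `≥ 0`, then `BQ` holds
  (`blockQ9_of_patternBounds` with `pattern_median_two` on the median cells and `pattern_kappa` on the contact cells).  This is the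
  socket of the cellwise certificates WG-κ (= median ∨ contact, chosen cellwise) and WG-c of memo §53; 0 violations in every census
  so far, proof open.
-/

namespace Summit.CriticalPhenomena.PercolationContinuityZ3.Theorems

open MeasureTheory Set
open Literature.Probability.LatticeModels
open Literature.Probability.Percolation

noncomputable section
open Classical

namespace BlockQ9

variable {n : ℕ}

/-- **The contact (κ) pattern bound.**  Block `O`, boundary pairs `F` (none internal to `O`), pattern `T`, `Q_T = pinW w F T`
(unglued), `P_T = pinW (glue_O w) F T` (glued).  Then
`μ_{Q_T}(⋃_{o∈O} {o ↔ b}) − μ_{Q_T}({a ↔ b} ∪ ⋃_{o∈O} {a ↔ o}) ≤ μ_{P_T}(⋃_{o∈O} {o ↔ b}) − μ_{P_T}(a ↔ b)`.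
Proof: `P_T = glue_O Q_T` (`glue_pinW_comm`); push forward along `ω ↦ ω ∪ clique(O)` (`glueSet_pushforward`); `{O ↔ b}` is invariant
(`glue_preimage_iUnion_openConn`) and the pull-back of `{a ↔ b}` lies in `{a ↔ b} ∪ ⋃_o {a ↔ o}` (`reachable_or_exists_mem_of_glue`
applied from `b`). [cite: KozmaNitzan2024, Lemma 5 (p. 13), Question 9 (p. 36)] -/
theorem pattern_kappa (w : Sym2 (Fin n) → unitInterval) (O : Finset (Fin n)) (a b : Fin n)
    (F : Finset (Sym2 (Fin n))) (hFnint : ∀ f ∈ F, ¬ ((∀ x ∈ f, x ∈ O) ∧ ¬ f.IsDiag))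
    (T : Finset (Sym2 (Fin n))) :
    (prodBernoulli (pinW w (↑F : Set (Sym2 (Fin n))) ↑T)).real (⋃ o ∈ O, openConn o b) -
      (prodBernoulli (pinW w (↑F : Set (Sym2 (Fin n))) ↑T)).real (openConn a b ∪ ⋃ o ∈ O, openConn a o) ≤
    (prodBernoulli (pinW (fun e : Sym2 (Fin n) => if (∀ x ∈ e, x ∈ O) ∧ ¬ e.IsDiag then 1 else w e)
          (↑F : Set (Sym2 (Fin n))) ↑T)).real (⋃ o ∈ O, openConn o b) -
      (prodBernoulli (pinW (fun e : Sym2 (Fin n) => if (∀ x ∈ e, x ∈ O) ∧ ¬ e.IsDiag then 1 else w e)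
          (↑F : Set (Sym2 (Fin n))) ↑T)).real (openConn a b) := by
  set Q : Sym2 (Fin n) → unitInterval := pinW w (↑F : Set (Sym2 (Fin n))) ↑T with hQ
  set D : Set (Sym2 (Fin n)) := {e : Sym2 (Fin n) | (∀ x ∈ e, x ∈ O) ∧ ¬ e.IsDiag} with hD
  set P : Sym2 (Fin n) → unitInterval := fun e : Sym2 (Fin n) => if (∀ x ∈ e, x ∈ O) ∧ ¬ e.IsDiag then (1 : unitInterval) else Q e
    with hPdef
  have hP : pinW (fun e : Sym2 (Fin n) => if (∀ x ∈ e, x ∈ O) ∧ ¬ e.IsDiag then 1 else w e)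
      (↑F : Set (Sym2 (Fin n))) ↑T = P := by
    rw [hPdef, glue_pinW_comm w O F hFnint]
  rw [hP]
  -- push-forward along `ω ↦ ω ∪ D`
  have h1 : ∀ e ∈ D, P e = 1 := fun e he => by
    simp only [hPdef]; rw [if_pos (by simpa [hD] using he)]
  have h2 : ∀ e ∉ D, P e = Q e := fun e he => by
    simp only [hPdef]; rw [if_neg (by simpa [hD] using he)]
  have hpush := fun E : Set (BondConfig (Fin n)) => glueSet_pushforward Q P D h1 h2 E
  -- `{O ↔ b}` is invariant under gluing
  have hOb : (prodBernoulli P).real (⋃ o ∈ O, openConn o b) = (prodBernoulli Q).real (⋃ o ∈ O, openConn o b) := by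
    rw [hpush, show {ω : BondConfig (Fin n) | (ω ∪ D : BondConfig (Fin n)) ∈ ⋃ o ∈ O, (openConn o b : Set (BondConfig (Fin n)))} =
        ⋃ o ∈ O, openConn o b from glue_preimage_iUnion_openConn O b]
  -- the pull-back of `{a ↔ b}` lies in `{a ↔ b} ∪ ⋃_o {a ↔ o}`
  have hab : (prodBernoulli P).real (openConn a b) ≤ (prodBernoulli Q).real (openConn a b ∪ ⋃ o ∈ O, openConn a o) := by
    rw [hpush]
    refine measureReal_mono ?_ (measure_ne_top _ _)
    intro ω hω
    have hba : (openGraph (ω ∪ D : BondConfig (Fin n))).Reachable b a :=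
      (show (openGraph (ω ∪ D : BondConfig (Fin n))).Reachable a b from hω).symm
    rcases reachable_or_exists_mem_of_glue O hba with h | ⟨v, hv, hva⟩
    · exact Or.inl (show ω ∈ openConn a b from h.symm)
    · exact Or.inr (Set.mem_iUnion₂.2 ⟨v, hv, show ω ∈ openConn a v from hva.symm⟩)
  linarith

/-- **Two-hub block Question 9 from a median/contact certificate** (socket of WG-κ / WG-c, memo §53).  Two-hub block
`O = {u₁, u₂}` in the setting of `blockQ9_of_patternBounds`; `M`, `Kp` any sets of patterns (the median cells and the contact
cells; the remaining non-empty patterns enter exactly).  With `cw T = Π_{f∈F} w^T f`, `P_T` glued pinned, `Q_T` unglued pinned,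
`hᵢ T = μ_{Q_T}(uᵢ ↔ b) − μ_{Q_T}(a ↔ b)`:
if `0 ≤ Σ_{T ∉ M ∪ Kp} cw T (μ_{P_T}(O↔b) − μ_{P_T}(a↔b)) + Σ_{T ∈ M} cw T · median(h₁,0,h₂) + Σ_{T ∈ Kp ∖ M} cw T (μ_{Q_T}(O↔b) − μ_{Q_T}(a ↔ O ∪ b))`
then `μ_{glue_O w}(a ↔ b, O ↔ A) ≤ μ_{glue_O w}(O ↔ b)`. [cite: KozmaNitzan2024, Question 9 (p. 36), Lemma 5 (p. 13)] -/
theorem blockQ9_twoHub_of_medianKappaCertificate (w : Sym2 (Fin n) → unitInterval) {u₁ u₂ : Fin n} (h12 : u₁ ≠ u₂)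
    (A : Finset (Fin n)) (a b : Fin n)
    (hOA : Disjoint ({u₁, u₂} : Finset (Fin n)) A) (haO : a ∉ ({u₁, u₂} : Finset (Fin n))) (hbO : b ∉ ({u₁, u₂} : Finset (Fin n)))
    (hiso : ∀ x ∈ ({u₁, u₂} : Finset (Fin n)), ∀ y : Fin n, y ∉ ({u₁, u₂} : Finset (Fin n)) → y ∉ A → w s(x, y) = 0)
    (F : Finset (Sym2 (Fin n)))
    (hF : ∀ f ∈ F, ∃ p s₀ : Fin n, f = s(p, s₀) ∧ s₀ ∈ ({u₁, u₂} : Finset (Fin n)) ∧ p ∈ A ∧ p ∉ ({u₁, u₂} : Finset (Fin n)))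
    (hdom : ∀ v ∈ A, ∀ o ∈ ({u₁, u₂} : Finset (Fin n)), w s(o, v) ≠ 0 → s(o, v) ∉ F →
      (prodBernoulli (fun e : Sym2 (Fin n) => if (∃ x ∈ e, x ∈ ({u₁, u₂} : Finset (Fin n))) then 0 else w e)).real (openConn a b) ≤
        (prodBernoulli (fun e : Sym2 (Fin n) => if (∃ x ∈ e, x ∈ ({u₁, u₂} : Finset (Fin n))) then 0 else w e)).real (openConn v b))
    (M Kp : Finset (Finset (Sym2 (Fin n))))
    (hsum : 0 ≤
      ∑ T ∈ (F.powerset.erase ∅).filter (fun T => T ∉ M ∧ T ∉ Kp), (∏ f ∈ F, (if f ∈ T then (w f : ℝ) else 1 - (w f : ℝ))) *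
          ((prodBernoulli (pinW (fun e : Sym2 (Fin n) => if (∀ x ∈ e, x ∈ ({u₁, u₂} : Finset (Fin n))) ∧ ¬ e.IsDiag then 1 else w e)
              (↑F : Set (Sym2 (Fin n))) ↑T)).real (⋃ o ∈ ({u₁, u₂} : Finset (Fin n)), openConn o b) -
           (prodBernoulli (pinW (fun e : Sym2 (Fin n) => if (∀ x ∈ e, x ∈ ({u₁, u₂} : Finset (Fin n))) ∧ ¬ e.IsDiag then 1 else w e)
              (↑F : Set (Sym2 (Fin n))) ↑T)).real (openConn a b)) +
      ∑ T ∈ (F.powerset.erase ∅).filter (fun T => T ∈ M), (∏ f ∈ F, (if f ∈ T then (w f : ℝ) else 1 - (w f : ℝ))) *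
          max (min ((prodBernoulli (pinW w (↑F : Set (Sym2 (Fin n))) ↑T)).real (openConn u₁ b) -
                    (prodBernoulli (pinW w (↑F : Set (Sym2 (Fin n))) ↑T)).real (openConn a b))
                   ((prodBernoulli (pinW w (↑F : Set (Sym2 (Fin n))) ↑T)).real (openConn u₂ b) -
                    (prodBernoulli (pinW w (↑F : Set (Sym2 (Fin n))) ↑T)).real (openConn a b)))
              (min 0 (max ((prodBernoulli (pinW w (↑F : Set (Sym2 (Fin n))) ↑T)).real (openConn u₁ b) -
                    (prodBernoulli (pinW w (↑F : Set (Sym2 (Fin n))) ↑T)).real (openConn a b))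
                   ((prodBernoulli (pinW w (↑F : Set (Sym2 (Fin n))) ↑T)).real (openConn u₂ b) -
                    (prodBernoulli (pinW w (↑F : Set (Sym2 (Fin n))) ↑T)).real (openConn a b)))) +
      ∑ T ∈ (F.powerset.erase ∅).filter (fun T => T ∉ M ∧ T ∈ Kp), (∏ f ∈ F, (if f ∈ T then (w f : ℝ) else 1 - (w f : ℝ))) *
          ((prodBernoulli (pinW w (↑F : Set (Sym2 (Fin n))) ↑T)).real (⋃ o ∈ ({u₁, u₂} : Finset (Fin n)), openConn o b) -
           (prodBernoulli (pinW w (↑F : Set (Sym2 (Fin n))) ↑T)).real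
              (openConn a b ∪ ⋃ o ∈ ({u₁, u₂} : Finset (Fin n)), openConn a o))) :
    (prodBernoulli (fun e : Sym2 (Fin n) => if (∀ x ∈ e, x ∈ ({u₁, u₂} : Finset (Fin n))) ∧ ¬ e.IsDiag then 1 else w e)).real
        (openConn a b ∩ ⋃ o ∈ ({u₁, u₂} : Finset (Fin n)), ⋃ x ∈ A, openConn o x) ≤
      (prodBernoulli (fun e : Sym2 (Fin n) => if (∀ x ∈ e, x ∈ ({u₁, u₂} : Finset (Fin n))) ∧ ¬ e.IsDiag then 1 else w e)).real
        (⋃ o ∈ ({u₁, u₂} : Finset (Fin n)), openConn o b) := by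
  have hFnint : ∀ f ∈ F, ¬ ((∀ x ∈ f, x ∈ ({u₁, u₂} : Finset (Fin n))) ∧ ¬ f.IsDiag) := by
    intro f hf h
    obtain ⟨q, t, rfl, -, -, hqO⟩ := hF f hf
    exact hqO (h.1 q (Sym2.mem_mk_left q t))
  -- pattern values
  set ZD : Finset (Sym2 (Fin n)) → ℝ := fun T =>
    (prodBernoulli (pinW (fun e : Sym2 (Fin n) => if (∀ x ∈ e, x ∈ ({u₁, u₂} : Finset (Fin n))) ∧ ¬ e.IsDiag then 1 else w e)
        (↑F : Set (Sym2 (Fin n))) ↑T)).real (⋃ o ∈ ({u₁, u₂} : Finset (Fin n)), openConn o b) -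
    (prodBernoulli (pinW (fun e : Sym2 (Fin n) => if (∀ x ∈ e, x ∈ ({u₁, u₂} : Finset (Fin n))) ∧ ¬ e.IsDiag then 1 else w e)
        (↑F : Set (Sym2 (Fin n))) ↑T)).real (openConn a b) with hZD
  set med : Finset (Sym2 (Fin n)) → ℝ := fun T =>
    max (min ((prodBernoulli (pinW w (↑F : Set (Sym2 (Fin n))) ↑T)).real (openConn u₁ b) -
              (prodBernoulli (pinW w (↑F : Set (Sym2 (Fin n))) ↑T)).real (openConn a b))
             ((prodBernoulli (pinW w (↑F : Set (Sym2 (Fin n))) ↑T)).real (openConn u₂ b) -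
              (prodBernoulli (pinW w (↑F : Set (Sym2 (Fin n))) ↑T)).real (openConn a b)))
        (min 0 (max ((prodBernoulli (pinW w (↑F : Set (Sym2 (Fin n))) ↑T)).real (openConn u₁ b) -
              (prodBernoulli (pinW w (↑F : Set (Sym2 (Fin n))) ↑T)).real (openConn a b))
             ((prodBernoulli (pinW w (↑F : Set (Sym2 (Fin n))) ↑T)).real (openConn u₂ b) -
              (prodBernoulli (pinW w (↑F : Set (Sym2 (Fin n))) ↑T)).real (openConn a b)))) with hmed
  set kap : Finset (Sym2 (Fin n)) → ℝ := fun T =>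
    (prodBernoulli (pinW w (↑F : Set (Sym2 (Fin n))) ↑T)).real (⋃ o ∈ ({u₁, u₂} : Finset (Fin n)), openConn o b) -
    (prodBernoulli (pinW w (↑F : Set (Sym2 (Fin n))) ↑T)).real (openConn a b ∪ ⋃ o ∈ ({u₁, u₂} : Finset (Fin n)), openConn a o)
    with hkap
  set cw : Finset (Sym2 (Fin n)) → ℝ := fun T => ∏ f ∈ F, (if f ∈ T then (w f : ℝ) else 1 - (w f : ℝ)) with hcw
  set L : Finset (Sym2 (Fin n)) → ℝ := fun T => if T ∈ M then med T else if T ∈ Kp then kap T else ZD T with hLdef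
  have hmedle : ∀ T, med T ≤ ZD T := fun T => by
    simp only [hmed, hZD]; exact pattern_median_two w h12 a b F hFnint T
  have hkaple : ∀ T, kap T ≤ ZD T := fun T => by
    simp only [hkap, hZD]; exact pattern_kappa w {u₁, u₂} a b F hFnint T
  refine blockQ9_of_patternBounds w {u₁, u₂} A a b hOA haO hbO hiso F hF hdom L ?_ ?_
  · intro T _ _
    show L T ≤ ZD T
    simp only [hLdef]
    split_ifs
    · exact hmedle T
    · exact hkaple T
    · exact le_rfl
  · -- split the sum into the three classes
    set S := F.powerset.erase ∅ with hS
    have hsplit : ∑ T ∈ S, cw T * L T =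
        ∑ T ∈ S.filter (fun T => T ∈ M), cw T * L T + ∑ T ∈ S.filter (fun T => T ∉ M), cw T * L T := by
      rw [Finset.sum_filter_add_sum_filter_not]
    have hsplit2 : ∑ T ∈ S.filter (fun T => T ∉ M), cw T * L T =
        ∑ T ∈ (S.filter (fun T => T ∉ M)).filter (fun T => T ∈ Kp), cw T * L T +
        ∑ T ∈ (S.filter (fun T => T ∉ M)).filter (fun T => T ∉ Kp), cw T * L T := by
      rw [Finset.sum_filter_add_sum_filter_not]
    have hA : ∑ T ∈ S.filter (fun T => T ∈ M), cw T * L T = ∑ T ∈ S.filter (fun T => T ∈ M), cw T * med T :=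
      Finset.sum_congr rfl fun T hT => by
        have hTM : T ∈ M := (Finset.mem_filter.1 hT).2
        simp only [hLdef, if_pos hTM]
    have hB : ∑ T ∈ (S.filter (fun T => T ∉ M)).filter (fun T => T ∈ Kp), cw T * L T =
        ∑ T ∈ S.filter (fun T => T ∉ M ∧ T ∈ Kp), cw T * kap T := by
      rw [Finset.filter_filter]
      refine Finset.sum_congr rfl fun T hT => ?_
      obtain ⟨-, hTM, hTK⟩ := Finset.mem_filter.1 hT
      simp only [hLdef, if_neg hTM, if_pos hTK]
    have hC : ∑ T ∈ (S.filter (fun T => T ∉ M)).filter (fun T => T ∉ Kp), cw T * L T =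
        ∑ T ∈ S.filter (fun T => T ∉ M ∧ T ∉ Kp), cw T * ZD T := by
      rw [Finset.filter_filter]
      refine Finset.sum_congr rfl fun T hT => ?_
      obtain ⟨-, hTM, hTK⟩ := Finset.mem_filter.1 hT
      simp only [hLdef, if_neg hTM, if_neg hTK]
    show 0 ≤ ∑ T ∈ S, cw T * L T
    rw [hsplit, hsplit2, hA, hB, hC]
    have hsum' := hsum
    linarith

end BlockQ9

end

end Summit.CriticalPhenomena.PercolationContinuityZ3.Theorems
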